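import Summits.AtomisticToContinuum.HydrodynamicLimit.Theorems.EnskogAdjointDualityDualityReductionBalance
import Literature.Analysis.FluidPDE.HardSphereFlowJointMeasurable
import Literature.Analysis.FluidPDE.BoltzmannGradLimit
import Literature.MathematicalPhysics.KineticTheory.HardSphereBBGKYLiouvilleFlow
import Literature.MathematicalPhysics.KineticTheory.HardSphereEuler
import HarnessLib

/-!
# EnskogAdjointDuality / DualityReduction — helper 9: the pathwise duality estimate

Support lemmas for `Summit.AtomisticToContinuum.HydrodynamicLimit.Theses.EnskogAdjointDuality.DualityReduction`
(stmt-AtomisticToContinuum-11590). Along the orbit of ONE good datum `z` of a hard-sphere flow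
on `𝕋³`, for a test function `φ` that is `C¹` along free flight on `[0, t]` with defect
`|Dφ + Lφ| ≤ η(1+|v|²)` on `[0, t]`, the empirical identity of helper 1 and the bookkeeping
`R = (N+1)⁻¹ C − I₁ + ½ I₂` (collision residual), `Res = B_t − B_0 − I₃` (Enskog defect of the
Euler local Maxwellian) give the DETERMINISTIC estimate

`|A_t − B_t| ≤ |A_0 − B_0| + η t (1 + e(z)) + |I₃ + ½I₂| + |R| + |Res|`,

`A_s = (N+1)⁻¹ Σᵢ φ(s, zᵢ(s))`, `e(z) = (N+1)⁻¹ Σᵢ |vᵢ|²` (the free-streaming and collision-operator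
time integrals merge into `∫₀ᵗ ⟨μ_s, (D+L)φ_s⟩ ds`, bounded through the conserved kinetic energy).

* `integrableOn_enskogL_orbit` — `s ↦ ⟨μ_{z(s)}, L_s⟩` is integrable on `[0, t]` along a good orbit
  (measurable time-frozen modification of `L`, growth `K(1+|v|²)²`, bounded velocities);
* `pathwise_duality_bound` — the estimate above.

References: M. Pulvirenti, S. Simonella, arXiv:1504.03215, §2 [PulvirentiSimonella2016];
H. Spohn (1991), Part I §3.2 [Spohn1991].
-/

noncomputable section

open MeasureTheory Set Filter Topology Function
open scoped ENNReal BigOperators InnerProductSpace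

namespace Summit.AtomisticToContinuum.HydrodynamicLimit.Theorems

open Literature.Analysis.FluidPDE Literature.MathematicalPhysics.KineticTheory

variable {N : ℕ} {ε : ℝ}

/-- Along a good orbit each velocity is bounded by the conserved kinetic energy:
`|vᵢ(s)|² ≤ Σⱼ |vⱼ(s)|² = Σⱼ |vⱼ(0)|²`. [folklore] -/
theorem norm_sq_vel_flow_le (Φ : HardSphereFlow (Torus.geometry (Fin 3)) ε N)
    {z : Config N (Fin 3) T3} (hz : z ∈ Φ.good) (s : ℝ) (i : Fin N) :
    ‖(Φ.flow s z i).2‖ ^ 2 ≤ ∑ j, ‖(z j).2‖ ^ 2 := by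
  have hE : ∑ j, ‖(Φ.flow s z j).2‖ ^ 2 = ∑ j, ‖(z j).2‖ ^ 2 := by
    have h := Φ.configEnergy_flow hz s
    simp only [configEnergy] at h
    have h2 := congrArg (fun r : ℝ => 2 * r) h
    simp only [← mul_assoc] at h2
    norm_num at h2
    exact h2
  rw [← hE]
  exact Finset.single_le_sum (f := fun j => ‖(Φ.flow s z j).2‖ ^ 2) (fun j _ => sq_nonneg _)
    (Finset.mem_univ i)

/-- The sum of squared velocities is conserved along a good orbit. [folklore] -/
theorem sum_norm_sq_vel_flow (Φ : HardSphereFlow (Torus.geometry (Fin 3)) ε N)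
    {z : Config N (Fin 3) T3} (hz : z ∈ Φ.good) (s : ℝ) :
    ∑ j, ‖(Φ.flow s z j).2‖ ^ 2 = ∑ j, ‖(z j).2‖ ^ 2 := by
  have h := Φ.configEnergy_flow hz s
  simp only [configEnergy] at h
  have h2 := congrArg (fun r : ℝ => 2 * r) h
  simp only [← mul_assoc] at h2
  norm_num at h2
  exact h2

/-- **Integrability of the collision-operator term along a good orbit.** If on `[0, t]` the
kernel `L` has growth `|L(s, x, v)| ≤ K(1+|v|²)²` and its time-frozen modification
`(s, x, v) ↦ L(π s, x, v)` (`π` the projection onto `[0, t]`) is measurable, then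
`s ↦ ⟨μ_{z(s)}, L_s⟩ = (N)⁻¹ Σᵢ L(s, zᵢ(s))` is integrable on `[0, t]` along every good orbit
(velocities are bounded by the conserved energy). [folklore] -/
theorem integrableOn_enskogL_orbit (Φ : HardSphereFlow (Torus.geometry (Fin 3)) ε N)
    {z : Config N (Fin 3) T3} (hz : z ∈ Φ.good) {t : ℝ} (L : ℝ → T3 → V3 → ℝ) {K : ℝ}
    (hLb : ∀ s ∈ Icc 0 t, ∀ x v, |L s x v| ≤ K * (1 + ‖v‖ ^ 2) ^ 2)
    (hLm : Measurable fun p : ℝ × T3 × V3 => L (max 0 (min t p.1)) p.2.1 p.2.2) :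
    IntegrableOn (fun s => ∫ y, L s y.1 y.2 ∂(empiricalMeasure (Φ.flow s z))) (Icc 0 t) := by
  -- the integrand as a finite average
  have hsum : (fun s => ∫ y, L s y.1 y.2 ∂(empiricalMeasure (Φ.flow s z))) =
      fun s => (N : ℝ)⁻¹ * ∑ i, L s (Φ.flow s z i).1 (Φ.flow s z i).2 := by
    funext s
    exact integral_empiricalMeasure (Φ.flow s z) (fun y => L s y.1 y.2)
  rw [hsum]
  -- measurability via the frozen modification
  have horb : Measurable fun s : ℝ => Φ.flow s z :=
    Φ.measurable_flow_prod_torus.comp ((measurable_const (a := (⟨z, hz⟩ : Φ.good))).prodMk measurable_id)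
  have hmeas : Measurable fun s : ℝ =>
      (N : ℝ)⁻¹ * ∑ i, L (max 0 (min t s)) (Φ.flow s z i).1 (Φ.flow s z i).2 := by
    refine Measurable.const_mul ?_ _
    refine Finset.measurable_sum _ fun i _ => ?_
    have hi : Measurable fun s : ℝ => Φ.flow s z i := (measurable_pi_apply i).comp horb
    exact hLm.comp (measurable_id.prodMk (hi.fst.prodMk hi.snd))
  have hae : (fun s => (N : ℝ)⁻¹ * ∑ i, L s (Φ.flow s z i).1 (Φ.flow s z i).2) =ᵐ[volume.restrict (Icc 0 t)]
      fun s => (N : ℝ)⁻¹ * ∑ i, L (max 0 (min t s)) (Φ.flow s z i).1 (Φ.flow s z i).2 := by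
    filter_upwards [ae_restrict_mem measurableSet_Icc] with s hs
    rw [min_eq_right hs.2, max_eq_right hs.1]
  -- bound
  set E : ℝ := ∑ j, ‖(z j).2‖ ^ 2 with hE
  have hbd : ∀ s ∈ Icc 0 t,
      ‖(N : ℝ)⁻¹ * ∑ i, L s (Φ.flow s z i).1 (Φ.flow s z i).2‖ ≤ |K| * (1 + E) ^ 2 := by
    intro s hs
    rw [Real.norm_eq_abs, abs_mul, abs_of_nonneg (by positivity)]
    have hterm : ∀ i, |L s (Φ.flow s z i).1 (Φ.flow s z i).2| ≤ |K| * (1 + E) ^ 2 := by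
      intro i
      refine (hLb s hs _ _).trans ?_
      have hv := norm_sq_vel_flow_le Φ hz s i
      have h1 : (1 + ‖(Φ.flow s z i).2‖ ^ 2) ^ 2 ≤ (1 + E) ^ 2 :=
        pow_le_pow_left₀ (by positivity) (by linarith) 2
      calc K * (1 + ‖(Φ.flow s z i).2‖ ^ 2) ^ 2 ≤ |K| * (1 + ‖(Φ.flow s z i).2‖ ^ 2) ^ 2 :=
            mul_le_mul_of_nonneg_right (le_abs_self K) (by positivity)
        _ ≤ |K| * (1 + E) ^ 2 := mul_le_mul_of_nonneg_left h1 (abs_nonneg K)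
    rcases Nat.eq_zero_or_pos N with hN | hN
    · subst hN
      simp only [CharP.cast_eq_zero, inv_zero, zero_mul]
      positivity
    · have hNr : (0 : ℝ) < N := by exact_mod_cast hN
      calc (N : ℝ)⁻¹ * |∑ i, L s (Φ.flow s z i).1 (Φ.flow s z i).2|
          ≤ (N : ℝ)⁻¹ * ∑ i, |L s (Φ.flow s z i).1 (Φ.flow s z i).2| := by
            gcongr; exact Finset.abs_sum_le_sum_abs _ _
        _ ≤ (N : ℝ)⁻¹ * ∑ _i : Fin N, |K| * (1 + E) ^ 2 := by
            gcongr with i; exact hterm i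
        _ = |K| * (1 + E) ^ 2 := by
            rw [Finset.sum_const, Finset.card_univ, Fintype.card_fin, nsmul_eq_mul,
              inv_mul_cancel_left₀ hNr.ne']
  refine Integrable.congr ?_ hae.symm
  refine Measure.integrableOn_of_bounded (M := |K| * (1 + E) ^ 2) ?_ hmeas.aestronglyMeasurable ?_
  · rw [Real.volume_Icc]; exact ENNReal.ofReal_ne_top
  · filter_upwards [ae_restrict_mem measurableSet_Icc] with s hs
    rw [min_eq_right hs.2, max_eq_right hs.1]
    exact hbd s hs

/-- **The pathwise duality estimate.** For a good datum `z` of a hard-sphere flow of `N + 1`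
spheres on `𝕋³`, `0 < t`, a test function `φ` that is `C¹` along free flight on `[0, t]` with
defect `|Dφ + Lφ| ≤ η(1+|v|²)` there (`Dφ` the route's `derivWithin` along characteristics), the
collision-operator term integrable along the orbit, and real numbers tied by the bookkeeping of
the route — `R = (N+1)⁻¹ C − I₁ + ½I₂` with `C` the collision sum of `φ`-increments over
`(0, t]` and `I₁ = ∫₀ᵗ⟨μ_s, L_s⟩`, `Res = B_t − B_0 − I₃` — one has
`|A_t − B_t| ≤ |A_0 − B_0| + η t (1 + e(z)) + |I₃ + ½I₂| + |R| + |Res|`,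
`A_s = (N+1)⁻¹ Σᵢ φ(s, zᵢ(s))`, `e(z) = (N+1)⁻¹Σᵢ|vᵢ|²` (helper 1 + energy conservation).
[cite: PulvirentiSimonella2016, §2] -/
theorem pathwise_duality_bound (Φ : HardSphereFlow (Torus.geometry (Fin 3)) ε (N + 1))
    {z : Config (N + 1) (Fin 3) T3} (hz : z ∈ Φ.good) {t : ℝ} (ht : 0 < t)
    (φ L : ℝ → T3 → V3 → ℝ) {η : ℝ}
    (hφ : ∀ x v, ContDiffOn ℝ 1
      (fun r => φ r ((Torus.geometry (Fin 3)).translate x (r • v)) v) (Icc 0 t))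
    (hDL : ∀ s ∈ Icc 0 t, ∀ x v,
      |derivWithin (fun r => φ r ((Torus.geometry (Fin 3)).translate x ((r - s) • v)) v) (Icc 0 t) s +
        L s x v| ≤ η * (1 + ‖v‖ ^ 2))
    (hLint : IntegrableOn (fun s => ∫ y, L s y.1 y.2 ∂(empiricalMeasure (Φ.flow s z))) (Icc 0 t))
    {Rz Res I₂ I₃ Bt B0 : ℝ}
    (hR : Rz = ((N : ℝ) + 1)⁻¹ *
        (∑ᶠ (s : ℝ) (_ : s ∈ collisionTimes (Torus.geometry (Fin 3)) ε (fun r => Φ.flow r z) ∩ Ioc 0 t),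
          ∑ i : Fin (N + 1), ∑ j : Fin (N + 1),
            (if i ≠ j ∧ ‖(Torus.geometry (Fin 3)).sepVec (Φ.flow s z i).1 (Φ.flow s z j).1‖ = ε then
              φ s (Φ.flow s z i).1 (Φ.flow s z i).2 -
                φ s (Φ.flow s z i).1
                  (reflectVel ((Torus.geometry (Fin 3)).sepVec (Φ.flow s z i).1 (Φ.flow s z j).1)
                    ((Φ.flow s z i).2, (Φ.flow s z j).2)).1
            else 0)) -
        (∫ s in Icc 0 t, ∫ y, L s y.1 y.2 ∂(empiricalMeasure (Φ.flow s z))) + (1 / 2 : ℝ) * I₂)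
    (hRes : Res = Bt - B0 - I₃) :
    |((N : ℝ) + 1)⁻¹ * (∑ i, φ t (Φ.flow t z i).1 (Φ.flow t z i).2) - Bt| ≤
      |((N : ℝ) + 1)⁻¹ * (∑ i, φ 0 (z i).1 (z i).2) - B0| +
        η * t * (1 + ((N + 1 : ℕ) : ℝ)⁻¹ * ∑ i, ‖(z i).2‖ ^ 2) +
        |I₃ + (1 / 2 : ℝ) * I₂| + |Rz| + |Res| := by
  obtain ⟨hDint, hbal⟩ := empirical_balance_Icc Φ hz ht φ hφ
  -- abbreviations
  set n : ℝ := (N : ℝ) + 1 with hn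
  have hn' : ((N + 1 : ℕ) : ℝ) = n := by rw [hn]; push_cast; ring
  have hnpos : 0 < n := by rw [hn]; positivity
  set At : ℝ := n⁻¹ * ∑ i, φ t (Φ.flow t z i).1 (Φ.flow t z i).2 with hAt
  set A0 : ℝ := n⁻¹ * ∑ i, φ 0 (z i).1 (z i).2 with hA0
  set Dsum : ℝ → ℝ := fun s => ∑ i, derivWithin
      (fun r => φ r ((Torus.geometry (Fin 3)).translate (Φ.flow s z i).1
        ((r - s) • (Φ.flow s z i).2)) (Φ.flow s z i).2) (Icc 0 t) s with hDsum
  set Lsum : ℝ → ℝ := fun s => ∫ y, L s y.1 y.2 ∂(empiricalMeasure (Φ.flow s z)) with hLsum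
  set Csum : ℝ := ∑ᶠ (s : ℝ) (_ : s ∈ collisionTimes (Torus.geometry (Fin 3)) ε (fun r => Φ.flow r z) ∩ Ioc 0 t),
      ∑ i : Fin (N + 1), ∑ j : Fin (N + 1),
        (if i ≠ j ∧ ‖(Torus.geometry (Fin 3)).sepVec (Φ.flow s z i).1 (Φ.flow s z j).1‖ = ε then
          φ s (Φ.flow s z i).1 (Φ.flow s z i).2 -
            φ s (Φ.flow s z i).1
              (reflectVel ((Torus.geometry (Fin 3)).sepVec (Φ.flow s z i).1 (Φ.flow s z j).1)
                ((Φ.flow s z i).2, (Φ.flow s z j).2)).1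
        else 0) with hCsum
  set I₁ : ℝ := ∫ s in Icc 0 t, Lsum s with hI₁
  -- the balance law, divided by `n`
  have hbal' : At - A0 = n⁻¹ * (∫ s in Icc 0 t, Dsum s) + n⁻¹ * Csum := by
    have hb : (∑ i, φ t (Φ.flow t z i).1 (Φ.flow t z i).2) - (∑ i, φ 0 (z i).1 (z i).2) =
        (∫ s in Icc 0 t, Dsum s) + Csum := by
      rw [integral_Icc_eq_integral_Ioc, ← intervalIntegral.integral_of_le ht.le]
      exact hbal
    simp only [hAt, hA0]
    rw [← mul_sub, hb, mul_add]
  -- the merged transport + collision-operator integral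
  have hLsum_eq : ∀ s, Lsum s = ((N + 1 : ℕ) : ℝ)⁻¹ * ∑ i, L s (Φ.flow s z i).1 (Φ.flow s z i).2 :=
    fun s => integral_empiricalMeasure (Φ.flow s z) (fun y => L s y.1 y.2)
  have hDintOn : IntegrableOn Dsum (Icc 0 t) := by
    rw [integrableOn_Icc_iff_integrableOn_Ioc]
    exact (intervalIntegrable_iff_integrableOn_Ioc_of_le ht.le).1 hDint
  have hmerge : n⁻¹ * (∫ s in Icc 0 t, Dsum s) + I₁ = ∫ s in Icc 0 t, (n⁻¹ * Dsum s + Lsum s) := by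
    rw [integral_add (hDintOn.const_mul _) hLint, integral_const_mul]
  have henergy : ∀ s, ∑ i, ‖(Φ.flow s z i).2‖ ^ 2 = ∑ i, ‖(z i).2‖ ^ 2 :=
    fun s => sum_norm_sq_vel_flow Φ hz s
  have hptw : ∀ s ∈ Icc 0 t, ‖n⁻¹ * Dsum s + Lsum s‖ ≤
      η * (1 + ((N + 1 : ℕ) : ℝ)⁻¹ * ∑ i, ‖(z i).2‖ ^ 2) := by
    intro s hs
    have e1 : n⁻¹ * Dsum s + Lsum s = n⁻¹ * ∑ i, (derivWithin
        (fun r => φ r ((Torus.geometry (Fin 3)).translate (Φ.flow s z i).1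
          ((r - s) • (Φ.flow s z i).2)) (Φ.flow s z i).2) (Icc 0 t) s +
        L s (Φ.flow s z i).1 (Φ.flow s z i).2) := by
      rw [hLsum_eq s, hn', ← mul_add, ← Finset.sum_add_distrib]
    rw [e1, hn', Real.norm_eq_abs, abs_mul, abs_of_pos (inv_pos.2 hnpos)]
    calc n⁻¹ * |∑ i, (derivWithin
          (fun r => φ r ((Torus.geometry (Fin 3)).translate (Φ.flow s z i).1
            ((r - s) • (Φ.flow s z i).2)) (Φ.flow s z i).2) (Icc 0 t) s +
          L s (Φ.flow s z i).1 (Φ.flow s z i).2)|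
        ≤ n⁻¹ * ∑ i, |derivWithin
          (fun r => φ r ((Torus.geometry (Fin 3)).translate (Φ.flow s z i).1
            ((r - s) • (Φ.flow s z i).2)) (Φ.flow s z i).2) (Icc 0 t) s +
          L s (Φ.flow s z i).1 (Φ.flow s z i).2| := by
          gcongr; exact Finset.abs_sum_le_sum_abs _ _
      _ ≤ n⁻¹ * ∑ i, η * (1 + ‖(Φ.flow s z i).2‖ ^ 2) := by
          gcongr with i; exact hDL s hs _ _
      _ = η * (1 + n⁻¹ * ∑ i, ‖(z i).2‖ ^ 2) := by
          rw [← henergy s, ← Finset.mul_sum, Finset.sum_add_distrib, Finset.sum_const,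
            Finset.card_univ, Fintype.card_fin, nsmul_eq_mul, mul_one, hn']
          field_simp
  have hmergebd : |n⁻¹ * (∫ s in Icc 0 t, Dsum s) + I₁| ≤
      η * t * (1 + ((N + 1 : ℕ) : ℝ)⁻¹ * ∑ i, ‖(z i).2‖ ^ 2) := by
    rw [hmerge]
    have h := norm_setIntegral_le_of_norm_le_const (μ := (volume : Measure ℝ)) (s := Icc 0 t)
      (f := fun s => n⁻¹ * Dsum s + Lsum s) (by rw [Real.volume_Icc]; exact ENNReal.ofReal_lt_top) hptw
    rw [Real.norm_eq_abs, Real.volume_real_Icc_of_le ht.le, sub_zero] at h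
    refine h.trans (le_of_eq ?_)
    ring
  -- bookkeeping
  have hRz : Rz = n⁻¹ * Csum - I₁ + (1 / 2 : ℝ) * I₂ := by rw [hR]
  have hkey : At - Bt = (A0 - B0) + (n⁻¹ * (∫ s in Icc 0 t, Dsum s) + I₁) -
      (I₃ + (1 / 2 : ℝ) * I₂) + Rz - Res := by
    rw [hRz, hRes]
    linarith [hbal']
  rw [hkey]
  have h5 : ∀ a b c d e : ℝ, |a + b - c + d - e| ≤ |a| + |b| + |c| + |d| + |e| := by
    intro a b c d e
    calc |a + b - c + d - e| ≤ |a + b - c + d| + |e| := abs_sub _ _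
      _ ≤ |a + b - c| + |d| + |e| := by gcongr; exact abs_add_le _ _
      _ ≤ |a + b| + |c| + |d| + |e| := by gcongr; exact abs_sub _ _
      _ ≤ |a| + |b| + |c| + |d| + |e| := by gcongr; exact abs_add_le _ _
  refine (h5 _ _ _ _ _).trans ?_
  gcongr

end Summit.AtomisticToContinuum.HydrodynamicLimit.Theorems

end
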